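import Summits.AtomisticToContinuum.BoseEinsteinCondensation.Theorems.BECCutLineWeakDisorderWitnessTransferOccupationOneDimAux
import Summits.AtomisticToContinuum.BoseEinsteinCondensation.Theorems.BECCutLineWeakDisorderWitnessTransferCoreEntry
import Literature.MathematicalPhysics.QuantumManyBody.GroundStateFeynmanKacMarkov
import Literature.MathematicalPhysics.QuantumManyBody.GroundStateFeynmanKacGaussian
import Mathlib.Probability.BrownianMotion.Basic
import HarnessLib

/-!
# Route BECCutLineWeakDisorder — `WitnessTransfer`, one-dimensional occupation estimate II:
# moments of the occupation functional and stub (S2) `stub_oneDim_occupation_pz`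

Support file (does not close the item) for item stmt-AtomisticToContinuum-14978
(`Summit.AtomisticToContinuum.BoseEinsteinCondensation.Theses.BECCutLineWeakDisorder`, decl
`WitnessTransfer`): proves stub (S2) `stub_oneDim_occupation_pz` of line `Sketch`
(`Cruxes/WitnessTransfer/Lines/Sketch.lean`) with exactly the registered signature. For a
pre-Brownian motion `b` (measurable marginals, continuous paths), `T > 0` and a jointly measurable
windowed integrand `k : ℝ → ℝ → [0, ∞]` (`k_s` supported in `|u| ≤ 2√T`, `m ≤ ∫ k_s` on
`[T/2, T]`, `∫ k_s ≤ 2m` on `[0, T]`, `0 < m < ∞`):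
`P(∫_{(0,T]} k_s(b_s) ds ≥ (√T/1000) m) ≥ 10⁻⁴`.

With `J = ∫_{(0,T]} k_s(b_s) ds` and the generic tools of `…OccupationOneDimAux`:

* `measurable_occupationTimeIntegrand` — `(s, ω) ↦ k_s(b_s(ω))` is jointly measurable;
* `lintegral_occupationTime_comm` — `E J = ∫_{(0,T]} E[k_s(b_s)] ds` (Tonelli);
* `occupationTime_first_moment_ge` — `E J ≥ (T/2) · e^{-4}(2πT)^{-1/2} · m` (window lower bound
  of the `N(0, s)` density for `s ∈ [T/2, T]`);
* `occupationTime_marginal_le`, `occupationTime_first_moment_le` — `E[k_s(b_s)] ≤ (2πs)^{-1/2} 2m`,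
  `E J ≤ (2π)^{-1/2} 2√T · 2m < ∞`;
* `occupationTime_triangle_le`, `occupationTime_second_moment_le` —
  `E[J²] ≤ 2 · ((2π)^{-1/2} 2√T · 2m) · E J` (independent Gaussian increment, peak of its
  density, symmetry of the square);
* `sqrt_two_pi_lt`, `one_div_lt_exp_neg_four`, `two_mul_threshold_le`, `le_of_pz_constants` —
  the numerics `√(2π) < 2.6`, `e^{-4} > 1/55`, so `2 · (√T/1000) m ≤ E J` and `P ≥ e^{-4}/64 ≥ 10⁻⁴`;
* `stub_oneDim_occupation_pz` — Paley–Zygmund `E J ≤ 4C · P(J ≥ a)`.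

## References

* K. L. Chung, Z. Zhao, *From Brownian Motion to Schrödinger's Equation* (1995), §1.1–1.3
  (Gaussian transition density, Markov property). [ChungZhao1995]
-/

noncomputable section

open MeasureTheory ProbabilityTheory Filter Set Metric
open scoped ENNReal NNReal Topology

namespace Summit.AtomisticToContinuum.BoseEinsteinCondensation.Theorems.CutLineWitness

open Literature.MathematicalPhysics.QuantumManyBody.BoseGas
open Literature.Probability.Process

/-! ### Measurability -/

/-- The occupation integrand `(s, ω) ↦ k_s(b_s(ω))` is jointly measurable (paths continuous,
marginals measurable, `k` jointly measurable). [folklore] -/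
theorem measurable_occupationTimeIntegrand {Ω : Type*} [MeasurableSpace Ω] {b : ℝ≥0 → Ω → ℝ}
    (hbm : ∀ t, Measurable (b t)) (hbc : ∀ ω, Continuous (b · ω)) {k : ℝ → ℝ → ℝ≥0∞}
    (hk : Measurable (Function.uncurry k)) :
    Measurable (fun p : ℝ × Ω => k p.1 (b p.1.toNNReal p.2)) := by
  have h1 : Measurable (Function.uncurry b) :=
    measurable_uncurry_of_continuous_of_measurable hbc hbm
  have h2 : Measurable (fun p : ℝ × Ω => b p.1.toNNReal p.2) :=
    h1.comp ((measurable_real_toNNReal.comp measurable_fst).prodMk measurable_snd)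
  exact hk.comp (measurable_fst.prodMk h2)

/-- A time slice `k_s` of a jointly measurable `k` is measurable. [folklore] -/
theorem measurable_timeSlice {k : ℝ → ℝ → ℝ≥0∞} (hk : Measurable (Function.uncurry k)) (s : ℝ) :
    Measurable (k s) :=
  hk.comp measurable_prodMk_left

/-! ### First moment -/

/-- Tonelli: `E ∫_{(0,T]} k_s(b_s) ds = ∫_{(0,T]} E[k_s(b_s)] ds`. [folklore] -/
theorem lintegral_occupationTime_comm {Ω : Type*} [MeasurableSpace Ω] {P : Measure Ω} [SFinite P]
    {b : ℝ≥0 → Ω → ℝ} (hbm : ∀ t, Measurable (b t)) (hbc : ∀ ω, Continuous (b · ω)) {T : ℝ}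
    {k : ℝ → ℝ → ℝ≥0∞} (hk : Measurable (Function.uncurry k)) :
    ∫⁻ ω, (∫⁻ s in Ioc 0 T, k s (b s.toNNReal ω)) ∂P =
      ∫⁻ s in Ioc 0 T, ∫⁻ ω, k s (b s.toNNReal ω) ∂P :=
  lintegral_lintegral_swap (f := fun ω s => k s (b s.toNNReal ω))
    ((measurable_occupationTimeIntegrand hbm hbc hk).comp measurable_swap).aemeasurable

/-- **First moment, lower bound**: `E J ≥ (T/2) · (e^{-4}(2πT)^{-1/2} · m)` (for `s ∈ [T/2, T]`
the density of `b_s ~ N(0, s)` is `≥ e^{-4}(2πT)^{-1/2}` on the support of `k_s`). [folklore] -/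
theorem occupationTime_first_moment_ge {Ω : Type*} [MeasurableSpace Ω] {P : Measure Ω}
    [IsProbabilityMeasure P] {b : ℝ≥0 → Ω → ℝ} (hb : IsPreBrownianReal b P)
    (hbm : ∀ t, Measurable (b t)) (hbc : ∀ ω, Continuous (b · ω)) {T : ℝ} (hT : 0 < T)
    {k : ℝ → ℝ → ℝ≥0∞} (hk : Measurable (Function.uncurry k)) {m : ℝ≥0∞}
    (hsupp : ∀ s u, k s u ≠ 0 → |u| ≤ 2 * Real.sqrt T)
    (hlow : ∀ s ∈ Set.Icc (T / 2) T, m ≤ ∫⁻ u, k s u) :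
    ENNReal.ofReal (T / 2) * (ENNReal.ofReal ((√(2 * Real.pi * T))⁻¹ * Real.exp (-4)) * m) ≤
      ∫⁻ ω, (∫⁻ s in Ioc 0 T, k s (b s.toNNReal ω)) ∂P := by
  rw [lintegral_occupationTime_comm hbm hbc hk]
  calc ENNReal.ofReal (T / 2) * (ENNReal.ofReal ((√(2 * Real.pi * T))⁻¹ * Real.exp (-4)) * m)
      = ∫⁻ _ in Icc (T / 2) T, ENNReal.ofReal ((√(2 * Real.pi * T))⁻¹ * Real.exp (-4)) * m := by
        rw [setLIntegral_const, Real.volume_Icc, show T - T / 2 = T / 2 by ring, mul_comm]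
    _ ≤ ∫⁻ s in Icc (T / 2) T, ∫⁻ ω, k s (b s.toNNReal ω) ∂P := by
        refine setLIntegral_mono' measurableSet_Icc fun s hs => ?_
        have hs0 : 0 ≤ s := by linarith [hs.1, hT.le]
        have hsv : ((s.toNNReal : ℝ≥0) : ℝ) = s := Real.coe_toNNReal _ hs0
        rw [(hb.hasLaw_eval s.toNNReal).lintegral_comp (measurable_timeSlice hk s).aemeasurable]
        calc ENNReal.ofReal ((√(2 * Real.pi * T))⁻¹ * Real.exp (-4)) * m
            ≤ ENNReal.ofReal ((√(2 * Real.pi * T))⁻¹ * Real.exp (-4)) * ∫⁻ u, k s u := by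
              gcongr; exact hlow s hs
          _ ≤ _ := mul_lintegral_le_lintegral_gaussianReal_of_window hT (by rw [hsv]; exact hs.1)
              (by rw [hsv]; exact hs.2) (hsupp s)
    _ ≤ ∫⁻ s in Ioc 0 T, ∫⁻ ω, k s (b s.toNNReal ω) ∂P :=
        lintegral_mono_set fun s hs => ⟨by linarith [hs.1], hs.2⟩

/-- Marginal bound: for `s ∈ (0, T]`, `E[k_s(b_s)] ≤ (2πs)^{-1/2} · 2m`. [folklore] -/
theorem occupationTime_marginal_le {Ω : Type*} [MeasurableSpace Ω] {P : Measure Ω}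
    [IsProbabilityMeasure P] {b : ℝ≥0 → Ω → ℝ} (hb : IsPreBrownianReal b P) {T : ℝ}
    {k : ℝ → ℝ → ℝ≥0∞} (hk : Measurable (Function.uncurry k)) {m : ℝ≥0∞}
    (hup : ∀ s ∈ Set.Icc 0 T, ∫⁻ u, k s u ≤ 2 * m) {s : ℝ} (hs : s ∈ Ioc 0 T) :
    ∫⁻ ω, k s (b s.toNNReal ω) ∂P ≤ ENNReal.ofReal ((√(2 * Real.pi * s))⁻¹) * (2 * m) := by
  rw [(hb.hasLaw_eval s.toNNReal).lintegral_comp (measurable_timeSlice hk s).aemeasurable]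
  have hs0 : s.toNNReal ≠ 0 := by simpa using hs.1
  calc ∫⁻ u, k s u ∂gaussianReal 0 s.toNNReal
      ≤ ENNReal.ofReal ((√(2 * Real.pi * (s.toNNReal : ℝ≥0)))⁻¹) * ∫⁻ u, k s u :=
        lintegral_gaussianReal_le_peak_mul 0 hs0 _
    _ ≤ _ := by
        rw [Real.coe_toNNReal _ hs.1.le]
        gcongr
        exact hup s ⟨hs.1.le, hs.2⟩

/-- **First moment, upper bound**: `E J ≤ (2π)^{-1/2} 2√T · 2m` (finite). [folklore] -/
theorem occupationTime_first_moment_le {Ω : Type*} [MeasurableSpace Ω] {P : Measure Ω}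
    [IsProbabilityMeasure P] {b : ℝ≥0 → Ω → ℝ} (hb : IsPreBrownianReal b P)
    (hbm : ∀ t, Measurable (b t)) (hbc : ∀ ω, Continuous (b · ω)) {T : ℝ} (hT : 0 < T)
    {k : ℝ → ℝ → ℝ≥0∞} (hk : Measurable (Function.uncurry k)) {m : ℝ≥0∞}
    (hup : ∀ s ∈ Set.Icc 0 T, ∫⁻ u, k s u ≤ 2 * m) :
    ∫⁻ ω, (∫⁻ s in Ioc 0 T, k s (b s.toNNReal ω)) ∂P ≤
      ENNReal.ofReal ((√(2 * Real.pi))⁻¹ * (2 * √T)) * (2 * m) := by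
  rw [lintegral_occupationTime_comm hbm hbc hk, ← lintegral_Ioc_peak hT,
    ← lintegral_mul_const _ (by fun_prop)]
  exact setLIntegral_mono' measurableSet_Ioc fun s hs => occupationTime_marginal_le hb hk hup hs

/-! ### Second moment -/

/-- **The ordered two-time integral**: with `F_s = k_s(b_s)`,
`E ∫_{(0,T]} ∫_{(0,T]} 𝟙_{s<s'} F_s F_{s'} ds' ds ≤ E J · ((2π)^{-1/2} 2√T · 2m)` (independent
Gaussian increment `b_{s'} − b_s`, peak of its density, `∫ k_{s'} ≤ 2m`, and
`∫_{s<s'≤T} (2π(s'−s))^{-1/2} ds' ≤ (2π)^{-1/2} 2√T`). [folklore] -/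
theorem occupationTime_triangle_le {Ω : Type*} [MeasurableSpace Ω] {P : Measure Ω}
    [IsProbabilityMeasure P] {b : ℝ≥0 → Ω → ℝ} (hb : IsPreBrownianReal b P)
    (hbm : ∀ t, Measurable (b t)) (hbc : ∀ ω, Continuous (b · ω)) {T : ℝ} (hT : 0 < T)
    {k : ℝ → ℝ → ℝ≥0∞} (hk : Measurable (Function.uncurry k)) {m : ℝ≥0∞}
    (hup : ∀ s ∈ Set.Icc 0 T, ∫⁻ u, k s u ≤ 2 * m) :
    ∫⁻ ω, (∫⁻ s in Ioc 0 T, ∫⁻ s' in Ioc 0 T,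
        (Ioi s).indicator (fun s' => k s (b s.toNNReal ω) * k s' (b s'.toNNReal ω)) s') ∂P ≤
      (∫⁻ ω, (∫⁻ s in Ioc 0 T, k s (b s.toNNReal ω)) ∂P) *
        (ENNReal.ofReal ((√(2 * Real.pi))⁻¹ * (2 * √T)) * (2 * m)) := by
  have hF := measurable_occupationTimeIntegrand hbm hbc hk
  -- the triple integrand `((ω, s), s') ↦ 𝟙_{s<s'} F_s(ω) F_{s'}(ω)` is measurable
  have hH : Measurable (fun q : (Ω × ℝ) × ℝ => (Ioi q.1.2).indicator
      (fun s' => k q.1.2 (b q.1.2.toNNReal q.1.1) * k s' (b s'.toNNReal q.1.1)) q.2) := by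
    have e : (fun q : (Ω × ℝ) × ℝ => (Ioi q.1.2).indicator
        (fun s' => k q.1.2 (b q.1.2.toNNReal q.1.1) * k s' (b s'.toNNReal q.1.1)) q.2) =
        {q : (Ω × ℝ) × ℝ | q.1.2 < q.2}.indicator
          (fun q => k q.1.2 (b q.1.2.toNNReal q.1.1) * k q.2 (b q.2.toNNReal q.1.1)) := by
      ext q; simp only [Set.indicator, mem_Ioi, mem_setOf_eq]
    rw [e]
    refine Measurable.indicator ?_
      (measurableSet_lt (measurable_snd.comp measurable_fst) measurable_snd)
    exact (hF.comp ((measurable_snd.comp measurable_fst).prodMk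
      (measurable_fst.comp measurable_fst))).mul
      (hF.comp (measurable_snd.prodMk (measurable_fst.comp measurable_fst)))
  have hg : Measurable fun s => ∫⁻ ω, k s (b s.toNNReal ω) ∂P := hF.lintegral_prod_right'
  have hc : Measurable fun u : ℝ => ENNReal.ofReal ((√(2 * Real.pi * u))⁻¹) := by fun_prop
  -- swap `ω` and `s`
  rw [lintegral_lintegral_swap (f := fun ω s => ∫⁻ s' in Ioc 0 T, (Ioi s).indicator
      (fun s' => k s (b s.toNNReal ω) * k s' (b s'.toNNReal ω)) s')
      hH.lintegral_prod_right'.aemeasurable,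
    lintegral_occupationTime_comm hbm hbc hk, ← lintegral_mul_const _ hg]
  refine setLIntegral_mono' measurableSet_Ioc fun s hs => ?_
  -- swap `ω` and `s'`
  have hHs : Measurable (fun q : Ω × ℝ => (Ioi s).indicator
      (fun s' => k s (b s.toNNReal q.1) * k s' (b s'.toNNReal q.1)) q.2) :=
    hH.comp ((measurable_fst.prodMk measurable_const).prodMk measurable_snd)
  rw [lintegral_lintegral_swap (f := fun ω s' => (Ioi s).indicator
      (fun s' => k s (b s.toNNReal ω) * k s' (b s'.toNNReal ω)) s') hHs.aemeasurable]
  have e2 : ∀ s', ∫⁻ ω, (Ioi s).indicator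
      (fun s' => k s (b s.toNNReal ω) * k s' (b s'.toNNReal ω)) s' ∂P =
      (Ioi s).indicator (fun s' => ∫⁻ ω, k s (b s.toNNReal ω) * k s' (b s'.toNNReal ω) ∂P) s' := by
    intro s'
    by_cases h : s' ∈ Ioi s <;> simp [h]
  simp_rw [e2]
  have hcs : Measurable fun s' => (Ioi s).indicator
      (fun s' => ENNReal.ofReal ((√(2 * Real.pi * (s' - s)))⁻¹)) s' :=
    (hc.comp (measurable_id.sub measurable_const)).indicator measurableSet_Ioi
  calc ∫⁻ s' in Ioc 0 T, (Ioi s).indicator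
        (fun s' => ∫⁻ ω, k s (b s.toNNReal ω) * k s' (b s'.toNNReal ω) ∂P) s'
      ≤ ∫⁻ s' in Ioc 0 T, (Ioi s).indicator (fun s' => (∫⁻ ω, k s (b s.toNNReal ω) ∂P) *
          (ENNReal.ofReal ((√(2 * Real.pi * (s' - s)))⁻¹) * (2 * m))) s' := by
        refine setLIntegral_mono' measurableSet_Ioc fun s' hs' => ?_
        by_cases hss' : s' ∈ Ioi s
        · rw [indicator_of_mem hss', indicator_of_mem hss']
          have hlt : s.toNNReal < s'.toNNReal := (Real.toNNReal_lt_toNNReal_iff hs'.1).2 hss'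
          have h := lintegral_mul_eval_le_of_lt hb hlt (measurable_timeSlice hk s)
            (measurable_timeSlice hk s')
          rw [Real.coe_toNNReal _ hs.1.le, Real.coe_toNNReal _ hs'.1.le] at h
          refine h.trans ?_
          gcongr
          exact hup s' ⟨hs'.1.le, hs'.2⟩
        · simp [hss']
    _ = (∫⁻ ω, k s (b s.toNNReal ω) ∂P) * (2 * m) * ∫⁻ s' in Ioc 0 T, (Ioi s).indicator
          (fun s' => ENNReal.ofReal ((√(2 * Real.pi * (s' - s)))⁻¹)) s' := by
        rw [← lintegral_const_mul _ hcs]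
        refine lintegral_congr fun s' => ?_
        by_cases h : s' ∈ Ioi s
        · simp only [indicator_of_mem h]; ring
        · simp [h]
    _ ≤ (∫⁻ ω, k s (b s.toNNReal ω) ∂P) * (2 * m) *
          ∫⁻ u in Ioc 0 T, ENNReal.ofReal ((√(2 * Real.pi * u))⁻¹) := by
        exact mul_le_mul_right (lintegral_Ioc_indicator_shift_le hs.1.le _) _
    _ = (∫⁻ ω, k s (b s.toNNReal ω) ∂P) *
          (ENNReal.ofReal ((√(2 * Real.pi))⁻¹ * (2 * √T)) * (2 * m)) := by
        rw [lintegral_Ioc_peak hT]; ring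

/-- **Second moment**: `E[J²] ≤ 2 · ((2π)^{-1/2} 2√T · 2m) · E J`. [folklore] -/
theorem occupationTime_second_moment_le {Ω : Type*} [MeasurableSpace Ω] {P : Measure Ω}
    [IsProbabilityMeasure P] {b : ℝ≥0 → Ω → ℝ} (hb : IsPreBrownianReal b P)
    (hbm : ∀ t, Measurable (b t)) (hbc : ∀ ω, Continuous (b · ω)) {T : ℝ} (hT : 0 < T)
    {k : ℝ → ℝ → ℝ≥0∞} (hk : Measurable (Function.uncurry k)) {m : ℝ≥0∞}
    (hup : ∀ s ∈ Set.Icc 0 T, ∫⁻ u, k s u ≤ 2 * m) :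
    ∫⁻ ω, (∫⁻ s in Ioc 0 T, k s (b s.toNNReal ω)) ^ 2 ∂P ≤
      2 * (ENNReal.ofReal ((√(2 * Real.pi))⁻¹ * (2 * √T)) * (2 * m)) *
        ∫⁻ ω, (∫⁻ s in Ioc 0 T, k s (b s.toNNReal ω)) ∂P := by
  have hF := measurable_occupationTimeIntegrand hbm hbc hk
  have hFω : ∀ ω, Measurable fun s => k s (b s.toNNReal ω) := fun ω =>
    hF.comp measurable_prodMk_right
  calc ∫⁻ ω, (∫⁻ s in Ioc 0 T, k s (b s.toNNReal ω)) ^ 2 ∂P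
      = ∫⁻ ω, 2 * (∫⁻ s in Ioc 0 T, ∫⁻ s' in Ioc 0 T,
          (Ioi s).indicator (fun s' => k s (b s.toNNReal ω) * k s' (b s'.toNNReal ω)) s') ∂P := by
        refine lintegral_congr fun ω => ?_
        exact lintegral_sq_eq_two_mul_lintegral_indicator _ (hFω ω)
    _ = 2 * ∫⁻ ω, (∫⁻ s in Ioc 0 T, ∫⁻ s' in Ioc 0 T,
          (Ioi s).indicator (fun s' => k s (b s.toNNReal ω) * k s' (b s'.toNNReal ω)) s') ∂P :=
        lintegral_const_mul' _ _ ENNReal.ofNat_ne_top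
    _ ≤ 2 * ((∫⁻ ω, (∫⁻ s in Ioc 0 T, k s (b s.toNNReal ω)) ∂P) *
          (ENNReal.ofReal ((√(2 * Real.pi))⁻¹ * (2 * √T)) * (2 * m))) := by
        gcongr
        exact occupationTime_triangle_le hb hbm hbc hT hk hup
    _ = _ := by ring


/-! ### Numerical constants -/

/-- `√(2π) < 2.6`. [folklore] -/
theorem sqrt_two_pi_lt : √(2 * Real.pi) < 2.6 := by
  rw [Real.sqrt_lt' (by norm_num)]
  have := Real.pi_lt_d2
  norm_num
  linarith

/-- `1/55 < e^{-4}` (`e < 2.7182818286`). [folklore] -/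
theorem one_div_lt_exp_neg_four : (1 : ℝ) / 55 < Real.exp (-4) := by
  have h4 : Real.exp 4 < 55 := by
    have h : Real.exp 4 = Real.exp 1 ^ 4 := by rw [← Real.exp_nat_mul]; norm_num
    rw [h]
    have := Real.exp_one_lt_d9
    calc Real.exp 1 ^ 4 < 2.7182818286 ^ 4 := by gcongr
      _ < 55 := by norm_num
  rw [Real.exp_neg, inv_eq_one_div]
  exact one_div_lt_one_div_of_lt (Real.exp_pos 4) h4

/-- The threshold `(√T/1000) m` is at most half the first-moment lower bound
`(T/2) e^{-4}(2πT)^{-1/2} m` (`2√(2π) e⁴ ≤ 500`). [folklore] -/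
theorem two_mul_threshold_le {T : ℝ} (hT : 0 < T) (m : ℝ≥0∞) :
    2 * (ENNReal.ofReal (√T / 1000) * m) ≤
      ENNReal.ofReal (T / 2) * (ENNReal.ofReal ((√(2 * Real.pi * T))⁻¹ * Real.exp (-4)) * m) := by
  obtain ⟨ρ, hρ, rfl⟩ : ∃ ρ : ℝ, 0 < ρ ∧ ρ ^ 2 = T := ⟨√T, Real.sqrt_pos.2 hT, Real.sq_sqrt hT.le⟩
  have hσ := sqrt_two_pi_lt
  have hσpos : 0 < √(2 * Real.pi) := Real.sqrt_pos.2 (by positivity)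
  have hE := one_div_lt_exp_neg_four
  have e1 : (2 : ℝ≥0∞) * (ENNReal.ofReal (√(ρ ^ 2) / 1000) * m) = ENNReal.ofReal (ρ / 500) * m := by
    rw [← mul_assoc, Real.sqrt_sq hρ.le, ← ENNReal.ofReal_ofNat 2, ← ENNReal.ofReal_mul (by norm_num)]
    congr 2
    ring
  rw [e1, Real.sqrt_mul (by positivity), Real.sqrt_sq hρ.le, ← mul_assoc,
    ← ENNReal.ofReal_mul (by positivity)]
  gcongr
  have h5 : 2 * √(2 * Real.pi) ≤ 500 * Real.exp (-4) := by linarith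
  have e2 : ρ ^ 2 / 2 * ((√(2 * Real.pi) * ρ)⁻¹ * Real.exp (-4)) =
      ρ * Real.exp (-4) / (2 * √(2 * Real.pi)) := by
    field_simp
  rw [e2, div_le_div_iff₀ (by norm_num) (by positivity)]
  calc ρ * (2 * √(2 * Real.pi)) ≤ ρ * (500 * Real.exp (-4)) := by gcongr
    _ = ρ * Real.exp (-4) * 500 := by ring

/-- From `(T/2) e^{-4}(2πT)^{-1/2} m ≤ 4 · (2 (2π)^{-1/2} 2√T · 2m) · p` (first moment ≤
Paley–Zygmund bound) and `0 < m < ∞`: `10^{-4} ≤ p` (`p ≥ e^{-4}/64`). [folklore] -/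
theorem le_of_pz_constants {T : ℝ} (hT : 0 < T) {m p : ℝ≥0∞} (hm0 : m ≠ 0) (hmT : m ≠ ⊤)
    (h : ENNReal.ofReal (T / 2) * (ENNReal.ofReal ((√(2 * Real.pi * T))⁻¹ * Real.exp (-4)) * m) ≤
      4 * (2 * (ENNReal.ofReal ((√(2 * Real.pi))⁻¹ * (2 * √T)) * (2 * m))) * p) :
    ENNReal.ofReal (1 / 10000) ≤ p := by
  obtain ⟨ρ, hρ, rfl⟩ : ∃ ρ : ℝ, 0 < ρ ∧ ρ ^ 2 = T := ⟨√T, Real.sqrt_pos.2 hT, Real.sq_sqrt hT.le⟩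
  have hσpos : 0 < √(2 * Real.pi) := Real.sqrt_pos.2 (by positivity)
  have hE := one_div_lt_exp_neg_four
  rw [Real.sqrt_mul (by positivity), Real.sqrt_sq hρ.le] at h
  set α : ℝ := ρ ^ 2 / 2 * ((√(2 * Real.pi) * ρ)⁻¹ * Real.exp (-4)) with hα
  set β : ℝ := 16 * ((√(2 * Real.pi))⁻¹ * (2 * ρ)) with hβ
  have hβpos : 0 < β := by positivity
  have e1 : ENNReal.ofReal (ρ ^ 2 / 2) *
      (ENNReal.ofReal ((√(2 * Real.pi) * ρ)⁻¹ * Real.exp (-4)) * m) = ENNReal.ofReal α * m := by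
    rw [hα, ENNReal.ofReal_mul (p := ρ ^ 2 / 2) (by positivity), mul_assoc]
  have e2 : 4 * (2 * (ENNReal.ofReal ((√(2 * Real.pi))⁻¹ * (2 * ρ)) * (2 * m))) * p =
      ENNReal.ofReal β * p * m := by
    rw [hβ, ENNReal.ofReal_mul (p := 16) (by norm_num), show ENNReal.ofReal 16 = 16 from
      ENNReal.ofReal_ofNat 16]
    ring
  rw [e1, e2] at h
  have h' : ENNReal.ofReal α ≤ ENNReal.ofReal β * p := (ENNReal.mul_le_mul_iff_left hm0 hmT).1 h
  have h3 : ENNReal.ofReal (α / β) ≤ p := by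
    rw [ENNReal.ofReal_div_of_pos hβpos]
    exact ENNReal.div_le_of_le_mul' h'
  refine le_trans (ENNReal.ofReal_le_ofReal ?_) h3
  have hσ0 : √(2 * Real.pi) ≠ 0 := hσpos.ne'
  have hρ0 : ρ ≠ 0 := hρ.ne'
  have hαβ : α / β = Real.exp (-4) / 64 := by
    rw [hα, hβ]
    field_simp
    ring
  rw [hαβ]
  linarith

/-! ### The stub -/

/-- **(S2)** Let `b` be a pre-Brownian motion with measurable marginals and continuous paths, `T > 0`,
and `k : ℝ → ℝ → [0,∞]` (time, position) jointly measurable with `k_s` supported in `|u| ≤ 2√T`,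
`m ≤ ∫ k_s du` for `s ∈ [T/2, T]` and `∫ k_s du ≤ 2m` for `s ∈ [0, T]`, `0 < m < ∞`. Then
`P(∫₀ᵀ k_s(b_s) ds ≥ (√T/1000) m) ≥ 10⁻⁴` (first moment `≥ e^{-4}√T m/(2√(2π))`, second moment
`≤ (8/√(2π)) √T m ·` first moment, Paley–Zygmund). [folklore] -/
theorem stub_oneDim_occupation_pz {Ω : Type*} [MeasurableSpace Ω] {P : Measure Ω}
    [IsProbabilityMeasure P] {b : ℝ≥0 → Ω → ℝ} (hb : IsPreBrownianReal b P)
    (hbm : ∀ t, Measurable (b t)) (hbc : ∀ ω, Continuous (b · ω)) {T : ℝ} (hT : 0 < T)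
    {k : ℝ → ℝ → ℝ≥0∞} (hk : Measurable (Function.uncurry k)) {m : ℝ≥0∞} (hm0 : m ≠ 0)
    (hmT : m ≠ ⊤) (hsupp : ∀ s u, k s u ≠ 0 → |u| ≤ 2 * Real.sqrt T)
    (hlow : ∀ s ∈ Set.Icc (T / 2) T, m ≤ ∫⁻ u, k s u)
    (hup : ∀ s ∈ Set.Icc 0 T, ∫⁻ u, k s u ≤ 2 * m) :
    ENNReal.ofReal (1 / 10000) ≤
      P {ω | ENNReal.ofReal (Real.sqrt T / 1000) * m ≤ ∫⁻ s in Set.Ioc 0 T, k s (b s.toNNReal ω)} := by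
  have hJm : Measurable fun ω => ∫⁻ s in Ioc 0 T, k s (b s.toNNReal ω) :=
    (measurable_occupationTimeIntegrand hbm hbc hk).lintegral_prod_left'
  have h1 := occupationTime_first_moment_ge hb hbm hbc hT hk hsupp hlow
  have h1' := occupationTime_first_moment_le hb hbm hbc hT hk hup
  have h2 := occupationTime_second_moment_le hb hbm hbc hT hk hup
  have hfin : ∫⁻ ω, (∫⁻ s in Ioc 0 T, k s (b s.toNNReal ω)) ∂P ≠ ⊤ :=
    ne_top_of_le_ne_top (ENNReal.mul_ne_top ENNReal.ofReal_ne_top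
      (ENNReal.mul_ne_top ENNReal.ofNat_ne_top hmT)) h1'
  have hPZ := lintegral_le_mul_measure_ge_of_sq_le P hJm h2
    ((two_mul_threshold_le hT m).trans h1) hfin
  exact le_of_pz_constants hT hm0 hmT (h1.trans hPZ)

end Summit.AtomisticToContinuum.BoseEinsteinCondensation.Theorems.CutLineWitness
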